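import Summits.QuantumFields.YangMills.Theorems.VirialFluxGapCentralField
import Summits.QuantumFields.YangMills.Theorems.VirialFluxGapCentralCoercivity
import HarnessLib

/-!
# Route `VirialFluxGap` (YangMills): THE UNIFORM SLOT READING of the explicit central field — ONE formula for `centralDir` at EVERY ring variable,
# and the anchor pattern of the central projection (parallel slots ∕ consecutive slices ∕ seam sites share the anchor)

Toward ⟨stmt-QuantumFields-24141⟩ `VirialFluxGap.PeriodicSoftness`, clause (P2) (the drive) of the central package in w3 g59's per-term Euler-defect
form (F1 `EulerDefectAlgebra`, F2 `CentralDriveTerms`): each term of `ringPoly` has four slots, and F2 reads the direction of the explicit central field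
✓`centralDir` at each slot.  The tree has the reading in FOUR shapes (✓`centralDir_wrap`, ✓`centralDir_other`, ✓`centralDir_tree`, ✓`centralDir_seam`);
this file packages them into ONE formula valid at every ring variable `v`, so that a 4-slot term is instantiated without a 4⁴-fold case split:

* `slotQuat P v` — the unit quaternion of the ring history `P` at the ring variable `v` (`su2Quat (P.1 i e)` ∕ `su2Quat (P.2 x)`);
  `slotSign σ σ₄ v` — the anchor sign at `v` (`σ_k` at a wrap link of direction `k`, `σ₄` at a seam site, `0` at a plain link);
* ★★ `centralDir_slot` — on the central region of a slice-`0` comb-gauged ring history (`|z_k|², |z₄|² ≤ ½`), for EVERY `v`: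
  `centralDir σ σ₄ (ringCoord P) v = quatMatrix ⟨0, Im(conj(c_v)·q_v) + (s_v/2)·Im c_v⟩`, `q_v = slotQuat P v`, `c_v = slotQuat (π_C P) v` (the anchor),
  `s_v = slotSign σ σ₄ v` — wrap slots by ✓`centralDir_wrap`, plain slots (`c_v = 1`, `s_v = 0`) by ✓`centralDir_other`, slice-`0` comb-tree slots (`c_v = 1`
  and `q_v = 1` in tree gauge, so the formula gives `0`) by ✓`centralDir_tree`, seam slots by ✓`centralDir_seam`;
* the ANCHOR PATTERN: `slotQuat_centralProj_inl` (`c_{(i,e)} = liftQuat σ_k z_k` if `e` is a wrap link of direction `k`, else `1` — independent of the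
  slice `i`: `slotQuat_centralProj_slice`; equal on parallel links with the same wrap status: `slotQuat_centralProj_parallel`), `slotQuat_centralProj_inr`
  (`c_x = liftQuat σ₄ z₄` for every seam site: `slotQuat_centralProj_seam`), the sign twins, `norm_slotQuat` (`= 1`), and the anchors' deviation from `±1`
  (`norm_sq_smul_liftQuat_sub_one_le`: `‖σ·liftQuat σ z − 1‖² ≤ 2|z|²`);
* the UNIFORM PROXIMITY `norm_sq_slotQuat_sub_centralProj_le` ∕ `norm_slotQuat_sub_centralProj_le`: `‖q_v − c_v‖² ≤ 9216·L⁴·F₀(P)` (`‖q_v − c_v‖ ≤ 96L²√F₀`)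
  at every `v` (✓`norm_sq_slice_sub_centralProj_le`, ✓`norm_sq_seam_sub_centralProj_le`).

HONEST FRAMING: plumbing (two readers + the case packaging of landed lemmas; 0 `sorry`, standard axioms); no drive ∕ divergence inequality is proved here;
⟨24141⟩ and ⟨22884⟩ stay OPEN; no stub ∕ crux ∕ rung ∕ summit is closed; the Yang–Mills mass gap is NOT proved; no summit is proved by a line.  Width seat
`ym-line-sfw-p2-w2` g52 (cell ym-idea-1, free hands; taken at w3 g59's request 2026-08-31T03:18Z), `--supports stmt-QuantumFields-24141`.
References: [cite: CosteEtAl1985] (zero modes of the twisted finite-volume theory: the central ∕ toron directions); [cite: Luscher1983, §2]; [folklore].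
-/

set_option autoImplicit false

noncomputable section

open scoped Matrix BigOperators Quaternion
open Literature.MathematicalPhysics.QuantumFieldTheory hiding SU2
open Literature.MathematicalPhysics.QuantumLattice

namespace Summit.QuantumFields.YangMills.Theorems.VirialFluxGap.CentralSlotReading

open Summit.QuantumFields.YangMills.Theorems.FemtoTransferGap
open Summit.QuantumFields.YangMills.Theorems.FemtoTransferGap.TwoLattice.Flat (combFlat combFlat_apply wrapReps)
open Summit.QuantumFields.YangMills.Theorems.VirialFluxGap.RingDeficit
open Summit.QuantumFields.YangMills.Theorems.VirialFluxGap.FrameDerivative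
open Summit.QuantumFields.YangMills.Theorems.VirialFluxGap.FrameHessian
open Summit.QuantumFields.YangMills.Theorems.VirialFluxGap.FixFrame
open Summit.QuantumFields.YangMills.Theorems.VirialFluxGap.CentralField
open Summit.QuantumFields.YangMills.Theorems.VirialFluxGap.CentralCoercivity
open Summit.QuantumFields.YangMills.Theorems.VirialFluxGap.CombConstant
open Summit.QuantumFields.YangMills.Theorems.ToronValleyVolume.Lojasiewicz

variable {L : ℕ} [NeZero L]

/-! ## §1 The two readers -/

/-- The unit quaternion of a ring history at a ring variable: `su2Quat (P.1 i e)` at the link `e` of slice `i`, `su2Quat (P.2 x)` at the seam site `x`.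
[folklore] -/
def slotQuat (P : (Fin (2 * L - 1 + 1) → GaugeConfig 3 L SU2) × (Site 3 L → SU2)) : ((Fin (2 * L - 1 + 1) × Edge 3 L) ⊕ Site 3 L) → ℍ :=
  Sum.elim (fun ie => su2Quat (P.1 ie.1 ie.2)) (fun x => su2Quat (P.2 x))

/-- The ANCHOR SIGN at a ring variable: `σ_k` at a wrap link `(x,k)`, `x_k = −1`, of any slice; `σ₄` at a seam site; `0` at every other link
(there the anchor is `1` and the sign is immaterial). [cite: CosteEtAl1985] -/
def slotSign (σ : Fin 3 → ℝ) (σ₄ : ℝ) : ((Fin (2 * L - 1 + 1) × Edge 3 L) ⊕ Site 3 L) → ℝ :=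
  Sum.elim (fun ie => if ie.2.1 ie.2.2 = -1 then σ ie.2.2 else 0) (fun _ => σ₄)

omit [NeZero L] in
/-- `slotQuat` at a link. [folklore] -/
@[simp] theorem slotQuat_inl (P : (Fin (2 * L - 1 + 1) → GaugeConfig 3 L SU2) × (Site 3 L → SU2)) (i : Fin (2 * L - 1 + 1)) (e : Edge 3 L) :
    slotQuat P (Sum.inl (i, e)) = su2Quat (P.1 i e) := rfl

omit [NeZero L] in
/-- `slotQuat` at a seam site. [folklore] -/
@[simp] theorem slotQuat_inr (P : (Fin (2 * L - 1 + 1) → GaugeConfig 3 L SU2) × (Site 3 L → SU2)) (x : Site 3 L) :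
    slotQuat P (Sum.inr x) = su2Quat (P.2 x) := rfl

omit [NeZero L] in
/-- `slotSign` at a link `(x,k)` of slice `i`: `σ_k` if `x_k = −1`, else `0`. [folklore] -/
@[simp] theorem slotSign_inl (σ : Fin 3 → ℝ) (σ₄ : ℝ) (i : Fin (2 * L - 1 + 1)) (x : Site 3 L) (k : Fin 3) :
    slotSign σ σ₄ (Sum.inl (i, (x, k)) : (Fin (2 * L - 1 + 1) × Edge 3 L) ⊕ Site 3 L) = if x k = -1 then σ k else 0 := rfl

omit [NeZero L] in
/-- `slotSign` at a seam site: `σ₄`. [folklore] -/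
@[simp] theorem slotSign_inr (σ : Fin 3 → ℝ) (σ₄ : ℝ) (x : Site 3 L) :
    slotSign σ σ₄ (Sum.inr x : (Fin (2 * L - 1 + 1) × Edge 3 L) ⊕ Site 3 L) = σ₄ := rfl

omit [NeZero L] in
/-- Every slot quaternion is a unit. [folklore] -/
theorem norm_slotQuat (P : (Fin (2 * L - 1 + 1) → GaugeConfig 3 L SU2) × (Site 3 L → SU2)) (v : (Fin (2 * L - 1 + 1) × Edge 3 L) ⊕ Site 3 L) :
    ‖slotQuat P v‖ = 1 := by
  rcases v with ⟨i, e⟩ | x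
  · exact norm_su2Quat _
  · exact norm_su2Quat _

omit [NeZero L] in
/-- The anchor sign is locally a sign: `slotSign σ σ₄ v ∈ {σ_0, σ_1, σ_2, σ₄, 0}`; in particular `(slotSign σ σ₄ v)² ≤ 1` for signs `±1`. [folklore] -/
theorem slotSign_sq_le_one {σ : Fin 3 → ℝ} (hσ : ∀ k, σ k = 1 ∨ σ k = -1) {σ₄ : ℝ} (hσ₄ : σ₄ = 1 ∨ σ₄ = -1)
    (v : (Fin (2 * L - 1 + 1) × Edge 3 L) ⊕ Site 3 L) : (slotSign σ σ₄ v) ^ 2 ≤ 1 := by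
  rcases v with ⟨i, x, k⟩ | x
  · rw [slotSign_inl]
    split_ifs
    · rcases hσ k with h | h <;> simp [h]
    · simp
  · rw [slotSign_inr]
    rcases hσ₄ with h | h <;> simp [h]

/-! ## §2 The anchor pattern of the central projection -/

/-- ★ **The anchor at a link**: `slotQuat (π_C P) (i,e) = liftQuat σ_k z_k` if `e = (x,k)` is a wrap link (`x_k = −1`), `z_k = blockIm (wrapBlock k) k P`, and `1`
otherwise — independent of the slice `i`. [cite: CosteEtAl1985] -/
theorem slotQuat_centralProj_inl {σ : Fin 3 → ℝ} (hσ : ∀ k, σ k = 1 ∨ σ k = -1) (σ₄ : ℝ)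
    (P : (Fin (2 * L - 1 + 1) → GaugeConfig 3 L SU2) × (Site 3 L → SU2)) (i : Fin (2 * L - 1 + 1)) (e : Edge 3 L) :
    slotQuat (centralProj L σ σ₄ P) (Sum.inl (i, e)) =
      if e.1 e.2 = -1 then liftQuat (σ e.2) (blockIm L (wrapBlock L e.2) e.2 P) else 1 := by
  show su2Quat (combFlat (fun k => centralRep (σ k) (blockIm L (wrapBlock L k) k P)) e) = _
  rw [combFlat_apply]
  split_ifs with h
  · exact su2Quat_centralRep (sq_eq_one_of_sign (hσ e.2)) (normSq_blockIm_le_one _ e.2 P)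
  · exact su2Quat_one

/-- ★ **The anchor at a seam site**: `slotQuat (π_C P) x = liftQuat σ₄ z₄`, `z₄ = seamIm P` — the same for every site. [cite: CosteEtAl1985] -/
theorem slotQuat_centralProj_inr (σ : Fin 3 → ℝ) {σ₄ : ℝ} (hσ₄ : σ₄ = 1 ∨ σ₄ = -1)
    (P : (Fin (2 * L - 1 + 1) → GaugeConfig 3 L SU2) × (Site 3 L → SU2)) (x : Site 3 L) :
    slotQuat (centralProj L σ σ₄ P) (Sum.inr x) = liftQuat σ₄ (seamIm L P) := by
  show su2Quat (centralRep σ₄ (seamIm L P)) = _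
  exact su2Quat_centralRep (sq_eq_one_of_sign hσ₄) (normSq_seamIm_le_one P)

/-- Consecutive (indeed any two) slices share the anchor at the same link: the slots of a temporal bond have equal anchors. [folklore] -/
theorem slotQuat_centralProj_slice (σ : Fin 3 → ℝ) (σ₄ : ℝ) (P : (Fin (2 * L - 1 + 1) → GaugeConfig 3 L SU2) × (Site 3 L → SU2))
    (i i' : Fin (2 * L - 1 + 1)) (e : Edge 3 L) :
    slotQuat (centralProj L σ σ₄ P) (Sum.inl (i, e)) = slotQuat (centralProj L σ σ₄ P) (Sum.inl (i', e)) := rfl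

/-- ★ Parallel links with the same wrap status share the anchor: for `e = (x,k)`, `e' = (x',k)` with `x_k = x'_k` (the two `k`-links of a plaquette in a
`(k,l)`-plane, `l ≠ k`), `slotQuat (π_C P) (i,e) = slotQuat (π_C P) (i',e')`. [folklore] -/
theorem slotQuat_centralProj_parallel (σ : Fin 3 → ℝ) (σ₄ : ℝ) (P : (Fin (2 * L - 1 + 1) → GaugeConfig 3 L SU2) × (Site 3 L → SU2))
    (i i' : Fin (2 * L - 1 + 1)) {x x' : Site 3 L} (k : Fin 3) (h : x k = x' k) :
    slotQuat (centralProj L σ σ₄ P) (Sum.inl (i, (x, k))) = slotQuat (centralProj L σ σ₄ P) (Sum.inl (i', (x', k))) := by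
  show su2Quat (combFlat (fun k => centralRep (σ k) (blockIm L (wrapBlock L k) k P)) (x, k)) =
    su2Quat (combFlat (fun k => centralRep (σ k) (blockIm L (wrapBlock L k) k P)) (x', k))
  rw [combFlat_apply, combFlat_apply]
  simp only [h]

/-- All seam sites share the anchor. [folklore] -/
theorem slotQuat_centralProj_seam (σ : Fin 3 → ℝ) (σ₄ : ℝ) (P : (Fin (2 * L - 1 + 1) → GaugeConfig 3 L SU2) × (Site 3 L → SU2)) (x x' : Site 3 L) :
    slotQuat (centralProj L σ σ₄ P) (Sum.inr x) = slotQuat (centralProj L σ σ₄ P) (Sum.inr x') := rfl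

omit [NeZero L] in
/-- The anchor sign does not depend on the slice. [folklore] -/
theorem slotSign_slice (σ : Fin 3 → ℝ) (σ₄ : ℝ) (i i' : Fin (2 * L - 1 + 1)) (e : Edge 3 L) :
    slotSign σ σ₄ (Sum.inl (i, e) : (Fin (2 * L - 1 + 1) × Edge 3 L) ⊕ Site 3 L) = slotSign σ σ₄ (Sum.inl (i', e)) := rfl

omit [NeZero L] in
/-- Parallel links with the same wrap status carry the same anchor sign. [folklore] -/
theorem slotSign_parallel (σ : Fin 3 → ℝ) (σ₄ : ℝ) (i i' : Fin (2 * L - 1 + 1)) {x x' : Site 3 L} (k : Fin 3) (h : x k = x' k) :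
    slotSign σ σ₄ (Sum.inl (i, (x, k)) : (Fin (2 * L - 1 + 1) × Edge 3 L) ⊕ Site 3 L) = slotSign σ σ₄ (Sum.inl (i', (x', k))) := by
  rw [slotSign_inl, slotSign_inl, h]

/-- On a slice-`0` comb-tree link the anchor is `1` (a tree link is never a wrap link). [folklore] -/
theorem slotQuat_centralProj_tree {σ : Fin 3 → ℝ} (hσ : ∀ k, σ k = 1 ∨ σ k = -1) (σ₄ : ℝ)
    (P : (Fin (2 * L - 1 + 1) → GaugeConfig 3 L SU2) × (Site 3 L → SU2)) (i : Fin (2 * L - 1 + 1)) {e : Edge 3 L} (he : treeEdge e = true) :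
    slotQuat (centralProj L σ σ₄ P) (Sum.inl (i, e)) = 1 := by
  rw [slotQuat_centralProj_inl hσ, if_neg (fun h => not_treeEdge_of_wrap h he)]

/-- In tree gauge the slice-`0` comb-tree links are `1`. [cite: SeilerLNP1982, §2] -/
theorem slotQuat_tree_eq_one (P : (Fin (2 * L - 1 + 1) → GaugeConfig 3 L SU2) × (Site 3 L → SU2)) (ht : treeGauge (P.1 0) = 1)
    {e : Edge 3 L} (he : treeEdge e = true) : slotQuat P (Sum.inl (0, e)) = 1 := by
  rw [slotQuat_inl, ← treeFix_eq_self_of_treeGauge_eq_one ht, treeFix_eq_one_of_treeEdge _ he, su2Quat_one]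

omit [NeZero L] in
/-- ★ **The anchors are `√2|z|`-close to `±1`**: `‖σ·liftQuat σ z − 1‖² = 2(1 − √(1−|z|²)) ≤ 2|z|²` for `σ = ±1`, `|z|² ≤ 1` (w3's `ρ̂`). [folklore] -/
theorem norm_sq_smul_liftQuat_sub_one_le {σ : ℝ} (hσ : σ = 1 ∨ σ = -1) {z : Fin 3 → ℝ} (hz : (z 0) ^ 2 + (z 1) ^ 2 + (z 2) ^ 2 ≤ 1) :
    ‖σ • liftQuat σ z - 1‖ ^ 2 ≤ 2 * ((z 0) ^ 2 + (z 1) ^ 2 + (z 2) ^ 2) := by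
  have hσ2 : σ ^ 2 = 1 := sq_eq_one_of_sign hσ
  set a := (z 0) ^ 2 + (z 1) ^ 2 + (z 2) ^ 2 with ha
  have ha0 : 0 ≤ a := by positivity
  set r := Real.sqrt (1 - a) with hr
  have hr0 : 0 ≤ r := Real.sqrt_nonneg _
  have hr2 : r ^ 2 = 1 - a := Real.sq_sqrt (by linarith)
  have hr1 : r ≤ 1 := by nlinarith
  have hnorm : ‖σ • liftQuat σ z - 1‖ ^ 2 = (r - 1) ^ 2 + a := by
    rw [norm_sq_eq_re_sq_add_imDot]
    simp only [liftQuat, Quaternion.re_sub, Quaternion.imI_sub, Quaternion.imJ_sub, Quaternion.imK_sub, Quaternion.re_smul, Quaternion.imI_smul,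
      Quaternion.imJ_smul, Quaternion.imK_smul, Quaternion.re_one, Quaternion.imI_one, Quaternion.imJ_one, Quaternion.imK_one, smul_eq_mul, ha]
    have h1 : σ * (σ * r) = r := by rw [← mul_assoc, ← sq, hσ2, one_mul]
    rw [h1]
    nlinarith [hσ2]
  rw [hnorm]
  nlinarith

/-! ## §3 ★★ The uniform slot reading of the explicit central field -/

/-- ★★ **THE UNIFORM SLOT READING.**  On the central region of a slice-`0` comb-gauged ring history (`treeGauge (P.1 0) = 1`, `|z_k|² ≤ ½` for the three
wrap-block averages, `|z₄|² ≤ ½` for the seam average; signs `σ_k, σ₄ = ±1`), at EVERY ring variable `v` the explicit central field reads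
`centralDir σ σ₄ (ringCoord P) v = quatMatrix ⟨0, Im(conj(c_v)·q_v) + (s_v/2)·Im c_v⟩` with `q_v = slotQuat P v`, anchor `c_v = slotQuat (π_C P) v`, sign
`s_v = slotSign σ σ₄ v`.  (Wrap: ✓`centralDir_wrap`; plain: `c_v = 1`, `s_v = 0`, ✓`centralDir_other`; slice-`0` tree: `c_v = q_v = 1`, both sides `0`,
✓`centralDir_tree`; seam: ✓`centralDir_seam`.) [cite: CosteEtAl1985] -/
theorem centralDir_slot {σ : Fin 3 → ℝ} (hσ : ∀ k, σ k = 1 ∨ σ k = -1) {σ₄ : ℝ} (hσ₄ : σ₄ = 1 ∨ σ₄ = -1)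
    (P : (Fin (2 * L - 1 + 1) → GaugeConfig 3 L SU2) × (Site 3 L → SU2)) (ht : treeGauge (P.1 0) = 1)
    (hz : ∀ k : Fin 3, (blockIm L (wrapBlock L k) k P 0) ^ 2 + (blockIm L (wrapBlock L k) k P 1) ^ 2 + (blockIm L (wrapBlock L k) k P 2) ^ 2 ≤ 1 / 2)
    (hz₄ : (seamIm L P 0) ^ 2 + (seamIm L P 1) ^ 2 + (seamIm L P 2) ^ 2 ≤ 1 / 2)
    (v : (Fin (2 * L - 1 + 1) × Edge 3 L) ⊕ Site 3 L) :
    centralDir L σ σ₄ (ringCoord L P) v =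
      quatMatrix ⟨0,
        (star (slotQuat (centralProj L σ σ₄ P) v) * slotQuat P v).imI + slotSign σ σ₄ v / 2 * (slotQuat (centralProj L σ σ₄ P) v).imI,
        (star (slotQuat (centralProj L σ σ₄ P) v) * slotQuat P v).imJ + slotSign σ σ₄ v / 2 * (slotQuat (centralProj L σ σ₄ P) v).imJ,
        (star (slotQuat (centralProj L σ σ₄ P) v) * slotQuat P v).imK + slotSign σ σ₄ v / 2 * (slotQuat (centralProj L σ σ₄ P) v).imK⟩ := by
  rcases v with ⟨i, x, k⟩ | y
  · by_cases hx : x k = -1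
    · -- wrap slot of block `k`
      have hc : su2Quat ((centralProj L σ σ₄ P).1 i (x, k)) = liftQuat (σ k) (blockIm L (wrapBlock L k) k P) := by
        have h := slotQuat_centralProj_inl hσ σ₄ P i (x, k)
        rwa [slotQuat_inl, if_pos hx] at h
      rw [centralDir_wrap hσ σ₄ P i hx (hz k), slotSign_inl, if_pos hx, slotQuat_inl P i (x, k), slotQuat_inl (centralProj L σ σ₄ P) i (x, k), hc]
      congr 1
      ext <;> dsimp only [liftQuat] <;> ring
    · by_cases hm : i = 0 ∧ treeEdge (x, k) = true
      · -- slice-0 comb-tree slot: both sides vanish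
        obtain ⟨rfl, he⟩ := hm
        rw [centralDir_tree σ σ₄ _ he, slotQuat_centralProj_tree hσ σ₄ P 0 he, slotQuat_tree_eq_one P ht he, slotSign_inl, if_neg hx]
        have h0 : (⟨0, (star (1 : ℍ) * 1).imI + 0 / 2 * (1 : ℍ).imI, (star (1 : ℍ) * 1).imJ + 0 / 2 * (1 : ℍ).imJ,
            (star (1 : ℍ) * 1).imK + 0 / 2 * (1 : ℍ).imK⟩ : ℍ) = 0 := by
          ext <;> simp
        have hq : quatMatrix ((0 : ℝ) • (1 : ℍ)) = ((0 : ℝ) : ℂ) • quatMatrix 1 := quatMatrix_smul 0 (1 : ℍ)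
        rw [zero_smul, Complex.ofReal_zero, zero_smul] at hq
        rw [h0]
        exact hq.symm
      · -- plain slot: anchor `1`, sign `0`
        have hc : slotQuat (centralProj L σ σ₄ P) (Sum.inl (i, (x, k))) = 1 := by
          rw [slotQuat_centralProj_inl hσ, if_neg hx]
        rw [centralDir_other σ σ₄ P i (x, k) hm hx, hc, slotSign_inl, if_neg hx, slotQuat_inl]
        congr 1
        ext <;> simp
  · -- seam slot
    have hc : su2Quat ((centralProj L σ σ₄ P).2 y) = liftQuat σ₄ (seamIm L P) := slotQuat_centralProj_inr σ hσ₄ P y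
    rw [centralDir_seam σ hσ₄ P y hz₄, slotSign_inr, slotQuat_inr P y, slotQuat_inr (centralProj L σ σ₄ P) y, hc]
    congr 1
    ext <;> dsimp only [liftQuat] <;> ring

/-! ## §4 The uniform proximity of the slots to their anchors -/

/-- ★ **Uniform proximity**: on the central region (slice `0` in comb gauge, `σ_k·Re q(w_k) ≥ ½`, `σ₄·Re q(P.2 0) ≥ ½`), at EVERY ring variable
`‖q_v − c_v‖² ≤ 9216·L⁴·F₀(P)` (links: ✓`norm_sq_slice_sub_centralProj_le`; seam sites: ✓`norm_sq_seam_sub_centralProj_le`, `5184 ≤ 9216`). [cite: CosteEtAl1985] -/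
theorem norm_sq_slotQuat_sub_centralProj_le (P : (Fin (2 * L - 1 + 1) → GaugeConfig 3 L SU2) × (Site 3 L → SU2))
    (ht : treeGauge (P.1 0) = 1) {σ : Fin 3 → ℝ} (hσ : ∀ k, σ k = 1 ∨ σ k = -1) {σ₄ : ℝ} (hσ₄ : σ₄ = 1 ∨ σ₄ = -1)
    (hW : ∀ k : Fin 3, (1 / 2 : ℝ) ≤ σ k * (su2Quat (wrapReps (P.1 0) k)).re) (hS : (1 / 2 : ℝ) ≤ σ₄ * (su2Quat (P.2 0)).re)
    (v : (Fin (2 * L - 1 + 1) × Edge 3 L) ⊕ Site 3 L) :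
    ‖slotQuat P v - slotQuat (centralProj L σ σ₄ P) v‖ ^ 2 ≤ 9216 * (L : ℝ) ^ 4 * ringDeficit L (fun _ => false) P := by
  rcases v with ⟨i, e⟩ | x
  · exact norm_sq_slice_sub_centralProj_le P ht hσ σ₄ hW i e
  · have h := norm_sq_seam_sub_centralProj_le P ht σ hσ₄ hS x
    have hF : 0 ≤ ringDeficit L (fun _ => false) P := ringDeficit_nonneg _ P
    have hL4 : 0 ≤ (L : ℝ) ^ 4 := by positivity
    rw [slotQuat_inr, slotQuat_inr]
    nlinarith [mul_nonneg hL4 hF]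

/-- The same in un-squared form: `‖q_v − c_v‖ ≤ 96·L²·√F₀(P)` at every ring variable (w3's `r`). [cite: CosteEtAl1985] -/
theorem norm_slotQuat_sub_centralProj_le (P : (Fin (2 * L - 1 + 1) → GaugeConfig 3 L SU2) × (Site 3 L → SU2))
    (ht : treeGauge (P.1 0) = 1) {σ : Fin 3 → ℝ} (hσ : ∀ k, σ k = 1 ∨ σ k = -1) {σ₄ : ℝ} (hσ₄ : σ₄ = 1 ∨ σ₄ = -1)
    (hW : ∀ k : Fin 3, (1 / 2 : ℝ) ≤ σ k * (su2Quat (wrapReps (P.1 0) k)).re) (hS : (1 / 2 : ℝ) ≤ σ₄ * (su2Quat (P.2 0)).re)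
    (v : (Fin (2 * L - 1 + 1) × Edge 3 L) ⊕ Site 3 L) :
    ‖slotQuat P v - slotQuat (centralProj L σ σ₄ P) v‖ ≤ 96 * (L : ℝ) ^ 2 * Real.sqrt (ringDeficit L (fun _ => false) P) := by
  have h := norm_sq_slotQuat_sub_centralProj_le P ht hσ hσ₄ hW hS v
  have hF : 0 ≤ ringDeficit L (fun _ => false) P := ringDeficit_nonneg _ P
  have hrhs : 0 ≤ 96 * (L : ℝ) ^ 2 * Real.sqrt (ringDeficit L (fun _ => false) P) := by positivity
  have hsq : (96 * (L : ℝ) ^ 2 * Real.sqrt (ringDeficit L (fun _ => false) P)) ^ 2 = 9216 * (L : ℝ) ^ 4 * ringDeficit L (fun _ => false) P := by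
    rw [mul_pow, mul_pow, Real.sq_sqrt hF]
    ring
  exact (abs_le_of_sq_le_sq' (by rw [hsq]; exact h) hrhs).2

end Summit.QuantumFields.YangMills.Theorems.VirialFluxGap.CentralSlotReading

end
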